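import Summits.BirchSwinnertonDyer.BirchSwinnertonDyer.Theorems.AlignedTransportAtTwoMainConjectureOfRankZeroBSDAtTwoSexticResolventExactSeeds
import Summits.BirchSwinnertonDyer.BirchSwinnertonDyer.Theorems.AlignedTransportAtTwoMainConjectureOfRankZeroBSDAtTwoCubicChevalleyRowN4771ClassNumber
import Summits.BirchSwinnertonDyer.BirchSwinnertonDyer.Theorems.AlignedTransportAtTwoMainConjectureOfRankZeroBSDAtTwoCubicChevalleyRowN4883ClassNumber
import Summits.BirchSwinnertonDyer.Rank1Residual.ManinAdditive.TwoEisensteinIndexAtTwo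
import HarnessLib

/-!
# Route `AlignedTransportAtTwo`, crux C2 `MainConjectureOfRankZeroBSDAtTwo` (stmt-BirchSwinnertonDyer-22298):
# SEXTIC ROWS III (part 2) — the composite odd-branch seeds: `e_n(ℚ(W[2])) = e_n(ℚ(√−N))` FOR EVERY `n`, and
# `λ₂(ℚ(W[2])) = 2, 2, 4, 4, 64` for `N = 1763, 2515, 3115, 4771, 4883`, UNCONDITIONAL — here `N = 4771, 4883`

Sequel of `…SexticNormRelationDescentSeedsB` / `…SignFree{,Mu}` (same seat bsd-line-att-p4 g29). HONEST FRAMING: WIDTH-5 attached prover seat on line `birth` of the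
lead `bsd-line-att-p2`; `--supports` stmt-BirchSwinnertonDyer-22298, closes nothing; BSD is NOT proved; crux C2, its verdict «blocked-on
`Rank1Residual.GreenbergMuConjectureIrreducible`» and every registered stub untouched. THEOREMS ONLY; instance bookkeeping.

WHAT. For the five COMPOSITE-conductor seeds of the odd-branch sub-cell (`N = 1763 = 41·43`, `2515 = 5·503`, `3115 = 5·7·89`, `4771 = 13·367`, `4883 = 19·257`;
`Δ_min = −N`, `E[2]` irreducible, the three cubic towers `2`-class-number free by g28's `classNumberPExp_cubicField_n<N>_eq_zero` — `h(ℚ(β)) = 1` kernel + Chevalley +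
Fukuda) the sign-free part B's EXACTNESS gives, for ANY cyclotomic `ℤ₂`-extensions `κ_T` of `T = ℚ(W[2])` and `κ_δ` of the resolvent `ℚ(δ) = ℚ(√−N)`:

* `classNumberPExp_divisionField_two_n<N>_eq_resolvent` — **`e_n(ℚ(W[2])) = e_n(ℚ(√−N))` for EVERY `n`**: the `2`-class number of the `n`-th layer of the
  `S₃`-SEXTIC tower is that of the imaginary QUADRATIC tower (degree `2·2ⁿ` instead of `6·2ⁿ`);
* `classicalLambda_resolvent_n<N>` — Ferrero–Kida (PROVED in the tree by att-p3 g32, `ferreroKida_classicalLambda_two_imaginaryQuadratic_holds`):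
  `μ₂(ℚ(√−N)) = 0`, `λ₂(ℚ(√−N)) = Σ_{ℓ ∣ N} 2^{ord₂(ℓ²−1)−3} − 1`;
* ★★ `classicalLambda_divisionField_two_n<N>` — **`μ₂(ℚ(W[2])^{cyc}) = 0` and `λ₂(ℚ(W[2])^{cyc}) = 2, 2, 4, 4, 64`** resp., UNCONDITIONAL —
  Iwasawa invariants of the cyclotomic `ℤ₂`-extension of a non-abelian sextic, computed in the kernel (no Riemann–Hurwitz/Kida formula for `T`, no
  Ferrero–Washington, no class group of degree `6·2ⁿ`).

(For the prime seeds `139`, `307`, `3371`, `3547` both towers have `e_n = 0`: parts 3 and SeedsB.) Nothing closed.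

References: [Schettler2014] Thm. 2 (Ferrero 1980 / Kida 1979); [BiasseEtAl2022] Prop. 3.7; [Washington1997] Thm. 10.8, §13.1, Thm. 13.13; tree: parts A–B (this seat),
`…CubicChevalleyRowN<N>ClassNumber` (g28), `…ResolventLambdaParity` (att-p3 g30), `FerreroKidaLambdaTwoImaginaryQuadraticProof` (att-p3 g32), `Rank1Residual/ManinAdditive/TwoEisensteinIndexAtTwo`
(`padicValNat_two_of_eq`).
-/

set_option linter.dupNamespace false
set_option autoImplicit false

noncomputable section

open scoped Classical NumberField

namespace Summit.BirchSwinnertonDyer.BirchSwinnertonDyer.Theorems.AlignedTransportAtTwoSexticResolventExactSeedsB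

open NumberField Polynomial WeierstrassCurve IntermediateField Field
  Literature.NumberTheory.EllipticCurves Literature.NumberTheory.EllipticCurves.Greenberg1999
  Literature.NumberTheory.EllipticCurves.DokchitserDokchitser2012
  Literature.NumberTheory.EllipticCurves.ZpExtension Literature.NumberTheory.GaloisRepresentations
  Literature.NumberTheory.IwasawaTheory Literature.NumberTheory.NumberFields
  Summit.BirchSwinnertonDyer.BirchSwinnertonDyer.Theorems.AlignedTransportAtTwoFineRoad.DivisionCubic
  Summit.BirchSwinnertonDyer.BirchSwinnertonDyer.Theorems.AlignedTransportAtTwoSexticNormRelationDescent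
  Summit.BirchSwinnertonDyer.BirchSwinnertonDyer.Theorems.AlignedTransportAtTwoSexticNormRelationDescentMu
  Summit.BirchSwinnertonDyer.BirchSwinnertonDyer.Theorems.AlignedTransportAtTwoSexticNormRelationDescentSignFree
  Summit.BirchSwinnertonDyer.BirchSwinnertonDyer.Theorems.AlignedTransportAtTwoSexticNormRelationDescentSignFreeMu
  Summit.BirchSwinnertonDyer.BirchSwinnertonDyer.Theorems.AlignedTransportAtTwoResolventLambdaParity
  Summit.BirchSwinnertonDyer.Rank1Residual.ManinAdditive
  Summit.BirchSwinnertonDyer.BirchSwinnertonDyer.Theorems.AlignedTransportAtTwoSexticResolventExactSeeds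
  Summit.BirchSwinnertonDyer.BirchSwinnertonDyer.Theorems.AlignedTransportAtTwoCubicChevalleyRowN4771
  Summit.BirchSwinnertonDyer.BirchSwinnertonDyer.Theorems.AlignedTransportAtTwoCubicChevalleyRowN4771ClassNumber
  Summit.BirchSwinnertonDyer.BirchSwinnertonDyer.Theorems.AlignedTransportAtTwoCubicChevalleyRowN4883
  Summit.BirchSwinnertonDyer.BirchSwinnertonDyer.Theorems.AlignedTransportAtTwoCubicChevalleyRowN4883ClassNumber

/-! ## `N = 4771 = 13·367`: `λ₂ = 2^0 + 2^2 − 1 = 4` -/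

/-- The three cubic towers of the seed of conductor `4771` are `2`-class-number free at the roots `β_j ∈ ℚ̄` (g28, `h(ℚ(β)) = 1` kernel). [cite: LMFDB, number field 3.1.4771.1] -/
theorem cubic_towers_two_free_n4771 [((⟨1, -1, 0, -11, -12⟩ : WeierstrassCurve ℤ).baseChange ℚ).IsElliptic] :
    ∀ j : Fin 3, ∀ κj : ZpExtension ↥ℚ⟮xT ((⟨1, -1, 0, -11, -12⟩ : WeierstrassCurve ℤ).baseChange ℚ) two_ne_zero j⟯ 2, κj.IsCyclotomic →
      ∀ n, classNumberPExp κj n = 0 := by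
  intro j κj hκj m
  have hβ : aeval (xT ((⟨1, -1, 0, -11, -12⟩ : WeierstrassCurve ℤ).baseChange ℚ) two_ne_zero j)
      ((⟨1, -1, 0, -11, -12⟩ : WeierstrassCurve ℤ).baseChange ℚ).twoTorsionPolynomial.toPoly = 0 :=
    (mem_rootSet_of_ne (twoTorsionPolynomial_toPoly_ne_zero _ two_ne_zero)).mp (xT_mem_rootSet _ two_ne_zero j)
  exact classNumberPExp_cubicField_n4771_eq_zero hβ κj hκj m

/-- **`e_n(ℚ(W[2])) = e_n(ℚ(√−4771))` for EVERY `n`**, `W` the odd-branch seed of conductor `4771 = 13·367`; `κ_T`, `κ_δ` ANY cyclotomic `ℤ₂`-extensions of the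
`S₃`-sextic `ℚ(W[2])` and of its resolvent `ℚ(δ) = ℚ(√−4771)`. UNCONDITIONAL (part B's exactness + g28's cubic rows). [cite: BiasseEtAl2022, Prop. 3.7]
[cite: Washington1997, Thm. 10.8 and §13.1] -/
theorem classNumberPExp_divisionField_two_n4771_eq_resolvent
    [((⟨1, -1, 0, -11, -12⟩ : WeierstrassCurve ℤ).baseChange ℚ).IsElliptic]
    (κk : ZpExtension ↥ℚ⟮4 * delta ((⟨1, -1, 0, -11, -12⟩ : WeierstrassCurve ℤ).baseChange ℚ) two_ne_zero⟯ 2) (hκk : κk.IsCyclotomic)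
    (κT : ZpExtension (((⟨1, -1, 0, -11, -12⟩ : WeierstrassCurve ℤ).baseChange ℚ).divisionField 2) 2) (hκT : κT.IsCyclotomic) (n : ℕ) :
    classNumberPExp κT n = classNumberPExp κk n := by
  have hΔ := Δ_n4771_neg
  have hsq : ¬ IsSquare ((⟨1, -1, 0, -11, -12⟩ : WeierstrassCurve ℤ).baseChange ℚ).Δ := fun ⟨r, hr⟩ ↦ by nlinarith [mul_self_nonneg r]
  have h2Δ : ¬ IsSquare (2 * ((⟨1, -1, 0, -11, -12⟩ : WeierstrassCurve ℤ).baseChange ℚ).Δ) := fun ⟨r, hr⟩ ↦ by nlinarith [mul_self_nonneg r]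
  exact classNumberPExp_divisionField_two_eq_resolvent_of_cubic _ not_hasRationalTwoTorsionX_n4771 hsq h2Δ cubic_towers_two_free_n4771 κk hκk κT hκT n

/-- **Ferrero–Kida for the resolvent of the seed of conductor `4771 = 13·367`**: `μ₂(ℚ(√−4771)) = 0` and `λ₂(ℚ(√−4771)) = 2^0 + 2^2 − 1 = 4`
(`κ_δ` any cyclotomic `ℤ₂`-extension of `ℚ(δ)`, `δ = 4δ₀`, `δ² = −4771`). [cite: Schettler2014, Thm. 2] -/
theorem classicalLambda_resolvent_n4771
    [((⟨1, -1, 0, -11, -12⟩ : WeierstrassCurve ℤ).baseChange ℚ).IsElliptic]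
    (κk : ZpExtension ↥ℚ⟮4 * delta ((⟨1, -1, 0, -11, -12⟩ : WeierstrassCurve ℤ).baseChange ℚ) two_ne_zero⟯ 2) (hκk : κk.IsCyclotomic) :
    ClassicalMuVanishes κk ∧ classicalLambda κk = 4 := by
  haveI : FiniteDimensional ℚ ↥ℚ⟮4 * delta ((⟨1, -1, 0, -11, -12⟩ : WeierstrassCurve ℤ).baseChange ℚ) two_ne_zero⟯ :=
    IntermediateField.adjoin.finiteDimensional ((AlgebraicClosure.isAlgebraic ℚ).isAlgebraic _).isIntegral
  haveI : NumberField ↥ℚ⟮4 * delta ((⟨1, -1, 0, -11, -12⟩ : WeierstrassCurve ℤ).baseChange ℚ) two_ne_zero⟯ := NumberField.mk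
  have hΔ : ((⟨1, -1, 0, -11, -12⟩ : WeierstrassCurve ℤ).baseChange ℚ).Δ = -((4771 : ℕ) : ℚ) * (1 : ℚ) ^ 2 := by
    rw [baseChange_int_Δ, M4771_Δ]; norm_num
  obtain ⟨hK2, hη⟩ := exists_sq_eq_neg_of_sq_eq ((⟨1, -1, 0, -11, -12⟩ : WeierstrassCurve ℤ).baseChange ℚ) (by norm_num : 2 < 4771) one_ne_zero hΔ (delta_mem_and_sq _).2
  have hd : Squarefree (4771 : ℕ) := by
    rw [show (4771 : ℕ) = 13 * 367 by norm_num]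
    exact (Nat.squarefree_mul (by norm_num)).mpr ⟨(Nat.prime_iff.mp (by norm_num)).squarefree, (Nat.prime_iff.mp (by norm_num)).squarefree⟩
  obtain ⟨hμ, hl⟩ := ferreroKida_classicalLambda_two_imaginaryQuadratic_holds _ 4771 hd (by norm_num) hK2 hη κk hκk
  refine ⟨hμ, ?_⟩
  have hs : ∑ p ∈ (4771 : ℕ).primeFactors.erase 2, 2 ^ (padicValNat 2 (p ^ 2 - 1) - 3) = 5 := by
    have hpf : (4771 : ℕ).primeFactors = {13, 367} := by
      rw [show (4771 : ℕ) = 13 * 367 by norm_num, Nat.primeFactors_mul (by norm_num) (by norm_num),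
        Nat.Prime.primeFactors (by norm_num), Nat.Prime.primeFactors (by norm_num)]
      decide
    rw [hpf, Finset.erase_eq_self.mpr (by decide), Finset.sum_pair (by norm_num),
      TwoEisenstein.padicValNat_two_of_eq (n := 13 ^ 2 - 1) (k := 3) (m := 21) (by norm_num) (by norm_num),
      TwoEisenstein.padicValNat_two_of_eq (n := 367 ^ 2 - 1) (k := 5) (m := 4209) (by norm_num) (by norm_num)]
    norm_num
  rw [hs] at hl
  omega

/-- ★★ **`μ₂(ℚ(W[2])^{cyc}) = 0` and `λ₂(ℚ(W[2])^{cyc}) = 4`**, `W` the odd-branch seed of conductor `4771 = 13·367`, for EVERY cyclotomic `ℤ₂`-extension of the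
`S₃`-sextic `ℚ(W[2])` — UNCONDITIONAL: the sextic tower's `e_n` are the resolvent's (previous theorems), whose invariants are Ferrero–Kida's. [cite: Schettler2014, Thm. 2]
[cite: Washington1997, §13.3 Thm. 13.13] [cite: LMFDB, number field 3.1.4771.1] -/
theorem classicalLambda_divisionField_two_n4771
    [((⟨1, -1, 0, -11, -12⟩ : WeierstrassCurve ℤ).baseChange ℚ).IsElliptic]
    (κT : ZpExtension (((⟨1, -1, 0, -11, -12⟩ : WeierstrassCurve ℤ).baseChange ℚ).divisionField 2) 2) (hκT : κT.IsCyclotomic) :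
    ClassicalMuVanishes κT ∧ classicalLambda κT = 4 := by
  haveI : FiniteDimensional ℚ ↥ℚ⟮4 * delta ((⟨1, -1, 0, -11, -12⟩ : WeierstrassCurve ℤ).baseChange ℚ) two_ne_zero⟯ :=
    IntermediateField.adjoin.finiteDimensional ((AlgebraicClosure.isAlgebraic ℚ).isAlgebraic _).isIntegral
  haveI : NumberField ↥ℚ⟮4 * delta ((⟨1, -1, 0, -11, -12⟩ : WeierstrassCurve ℤ).baseChange ℚ) two_ne_zero⟯ := NumberField.mk
  obtain ⟨κk, hκk⟩ := exists_cyclotomicZpExtension_holds ↥ℚ⟮4 * delta ((⟨1, -1, 0, -11, -12⟩ : WeierstrassCurve ℤ).baseChange ℚ) two_ne_zero⟯ 2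
  obtain ⟨hμk, hlk⟩ := classicalLambda_resolvent_n4771 κk hκk
  have hΔ := Δ_n4771_neg
  have hsq : ¬ IsSquare ((⟨1, -1, 0, -11, -12⟩ : WeierstrassCurve ℤ).baseChange ℚ).Δ := fun ⟨r, hr⟩ ↦ by nlinarith [mul_self_nonneg r]
  have h2Δ : ¬ IsSquare (2 * ((⟨1, -1, 0, -11, -12⟩ : WeierstrassCurve ℤ).baseChange ℚ).Δ) := fun ⟨r, hr⟩ ↦ by nlinarith [mul_self_nonneg r]
  refine ⟨(classicalMuVanishes_divisionField_two_iff_resolvent_of_cubic _ not_hasRationalTwoTorsionX_n4771 hsq h2Δ cubic_towers_two_free_n4771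
    κk hκk κT hκT).mpr hμk, ?_⟩
  rw [classicalLambda_divisionField_two_eq_resolvent_of_cubic _ not_hasRationalTwoTorsionX_n4771 hsq h2Δ cubic_towers_two_free_n4771 κk hκk κT hκT, hlk]

/-! ## `N = 4883 = 19·257`: `λ₂ = 2^0 + 2^6 − 1 = 64` -/

/-- The three cubic towers of the seed of conductor `4883` are `2`-class-number free at the roots `β_j ∈ ℚ̄` (g28, `h(ℚ(β)) = 1` kernel). [cite: LMFDB, number field 3.1.4883.1] -/
theorem cubic_towers_two_free_n4883 [((⟨1, 1, 0, -1, -4⟩ : WeierstrassCurve ℤ).baseChange ℚ).IsElliptic] :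
    ∀ j : Fin 3, ∀ κj : ZpExtension ↥ℚ⟮xT ((⟨1, 1, 0, -1, -4⟩ : WeierstrassCurve ℤ).baseChange ℚ) two_ne_zero j⟯ 2, κj.IsCyclotomic →
      ∀ n, classNumberPExp κj n = 0 := by
  intro j κj hκj m
  have hβ : aeval (xT ((⟨1, 1, 0, -1, -4⟩ : WeierstrassCurve ℤ).baseChange ℚ) two_ne_zero j)
      ((⟨1, 1, 0, -1, -4⟩ : WeierstrassCurve ℤ).baseChange ℚ).twoTorsionPolynomial.toPoly = 0 :=
    (mem_rootSet_of_ne (twoTorsionPolynomial_toPoly_ne_zero _ two_ne_zero)).mp (xT_mem_rootSet _ two_ne_zero j)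
  exact classNumberPExp_cubicField_n4883_eq_zero hβ κj hκj m

/-- **`e_n(ℚ(W[2])) = e_n(ℚ(√−4883))` for EVERY `n`**, `W` the odd-branch seed of conductor `4883 = 19·257`; `κ_T`, `κ_δ` ANY cyclotomic `ℤ₂`-extensions of the
`S₃`-sextic `ℚ(W[2])` and of its resolvent `ℚ(δ) = ℚ(√−4883)`. UNCONDITIONAL (part B's exactness + g28's cubic rows). [cite: BiasseEtAl2022, Prop. 3.7]
[cite: Washington1997, Thm. 10.8 and §13.1] -/
theorem classNumberPExp_divisionField_two_n4883_eq_resolvent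
    [((⟨1, 1, 0, -1, -4⟩ : WeierstrassCurve ℤ).baseChange ℚ).IsElliptic]
    (κk : ZpExtension ↥ℚ⟮4 * delta ((⟨1, 1, 0, -1, -4⟩ : WeierstrassCurve ℤ).baseChange ℚ) two_ne_zero⟯ 2) (hκk : κk.IsCyclotomic)
    (κT : ZpExtension (((⟨1, 1, 0, -1, -4⟩ : WeierstrassCurve ℤ).baseChange ℚ).divisionField 2) 2) (hκT : κT.IsCyclotomic) (n : ℕ) :
    classNumberPExp κT n = classNumberPExp κk n := by
  have hΔ := Δ_n4883_neg
  have hsq : ¬ IsSquare ((⟨1, 1, 0, -1, -4⟩ : WeierstrassCurve ℤ).baseChange ℚ).Δ := fun ⟨r, hr⟩ ↦ by nlinarith [mul_self_nonneg r]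
  have h2Δ : ¬ IsSquare (2 * ((⟨1, 1, 0, -1, -4⟩ : WeierstrassCurve ℤ).baseChange ℚ).Δ) := fun ⟨r, hr⟩ ↦ by nlinarith [mul_self_nonneg r]
  exact classNumberPExp_divisionField_two_eq_resolvent_of_cubic _ not_hasRationalTwoTorsionX_n4883 hsq h2Δ cubic_towers_two_free_n4883 κk hκk κT hκT n

/-- **Ferrero–Kida for the resolvent of the seed of conductor `4883 = 19·257`**: `μ₂(ℚ(√−4883)) = 0` and `λ₂(ℚ(√−4883)) = 2^0 + 2^6 − 1 = 64`
(`κ_δ` any cyclotomic `ℤ₂`-extension of `ℚ(δ)`, `δ = 4δ₀`, `δ² = −4883`). [cite: Schettler2014, Thm. 2] -/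
theorem classicalLambda_resolvent_n4883
    [((⟨1, 1, 0, -1, -4⟩ : WeierstrassCurve ℤ).baseChange ℚ).IsElliptic]
    (κk : ZpExtension ↥ℚ⟮4 * delta ((⟨1, 1, 0, -1, -4⟩ : WeierstrassCurve ℤ).baseChange ℚ) two_ne_zero⟯ 2) (hκk : κk.IsCyclotomic) :
    ClassicalMuVanishes κk ∧ classicalLambda κk = 64 := by
  haveI : FiniteDimensional ℚ ↥ℚ⟮4 * delta ((⟨1, 1, 0, -1, -4⟩ : WeierstrassCurve ℤ).baseChange ℚ) two_ne_zero⟯ :=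
    IntermediateField.adjoin.finiteDimensional ((AlgebraicClosure.isAlgebraic ℚ).isAlgebraic _).isIntegral
  haveI : NumberField ↥ℚ⟮4 * delta ((⟨1, 1, 0, -1, -4⟩ : WeierstrassCurve ℤ).baseChange ℚ) two_ne_zero⟯ := NumberField.mk
  have hΔ : ((⟨1, 1, 0, -1, -4⟩ : WeierstrassCurve ℤ).baseChange ℚ).Δ = -((4883 : ℕ) : ℚ) * (1 : ℚ) ^ 2 := by
    rw [baseChange_int_Δ, M4883_Δ]; norm_num
  obtain ⟨hK2, hη⟩ := exists_sq_eq_neg_of_sq_eq ((⟨1, 1, 0, -1, -4⟩ : WeierstrassCurve ℤ).baseChange ℚ) (by norm_num : 2 < 4883) one_ne_zero hΔ (delta_mem_and_sq _).2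
  have hd : Squarefree (4883 : ℕ) := by
    rw [show (4883 : ℕ) = 19 * 257 by norm_num]
    exact (Nat.squarefree_mul (by norm_num)).mpr ⟨(Nat.prime_iff.mp (by norm_num)).squarefree, (Nat.prime_iff.mp (by norm_num)).squarefree⟩
  obtain ⟨hμ, hl⟩ := ferreroKida_classicalLambda_two_imaginaryQuadratic_holds _ 4883 hd (by norm_num) hK2 hη κk hκk
  refine ⟨hμ, ?_⟩
  have hs : ∑ p ∈ (4883 : ℕ).primeFactors.erase 2, 2 ^ (padicValNat 2 (p ^ 2 - 1) - 3) = 65 := by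
    have hpf : (4883 : ℕ).primeFactors = {19, 257} := by
      rw [show (4883 : ℕ) = 19 * 257 by norm_num, Nat.primeFactors_mul (by norm_num) (by norm_num),
        Nat.Prime.primeFactors (by norm_num), Nat.Prime.primeFactors (by norm_num)]
      decide
    rw [hpf, Finset.erase_eq_self.mpr (by decide), Finset.sum_pair (by norm_num),
      TwoEisenstein.padicValNat_two_of_eq (n := 19 ^ 2 - 1) (k := 3) (m := 45) (by norm_num) (by norm_num),
      TwoEisenstein.padicValNat_two_of_eq (n := 257 ^ 2 - 1) (k := 9) (m := 129) (by norm_num) (by norm_num)]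
    norm_num
  rw [hs] at hl
  omega

/-- ★★ **`μ₂(ℚ(W[2])^{cyc}) = 0` and `λ₂(ℚ(W[2])^{cyc}) = 64`**, `W` the odd-branch seed of conductor `4883 = 19·257`, for EVERY cyclotomic `ℤ₂`-extension of the
`S₃`-sextic `ℚ(W[2])` — UNCONDITIONAL: the sextic tower's `e_n` are the resolvent's (previous theorems), whose invariants are Ferrero–Kida's. [cite: Schettler2014, Thm. 2]
[cite: Washington1997, §13.3 Thm. 13.13] [cite: LMFDB, number field 3.1.4883.1] -/
theorem classicalLambda_divisionField_two_n4883
    [((⟨1, 1, 0, -1, -4⟩ : WeierstrassCurve ℤ).baseChange ℚ).IsElliptic]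
    (κT : ZpExtension (((⟨1, 1, 0, -1, -4⟩ : WeierstrassCurve ℤ).baseChange ℚ).divisionField 2) 2) (hκT : κT.IsCyclotomic) :
    ClassicalMuVanishes κT ∧ classicalLambda κT = 64 := by
  haveI : FiniteDimensional ℚ ↥ℚ⟮4 * delta ((⟨1, 1, 0, -1, -4⟩ : WeierstrassCurve ℤ).baseChange ℚ) two_ne_zero⟯ :=
    IntermediateField.adjoin.finiteDimensional ((AlgebraicClosure.isAlgebraic ℚ).isAlgebraic _).isIntegral
  haveI : NumberField ↥ℚ⟮4 * delta ((⟨1, 1, 0, -1, -4⟩ : WeierstrassCurve ℤ).baseChange ℚ) two_ne_zero⟯ := NumberField.mk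
  obtain ⟨κk, hκk⟩ := exists_cyclotomicZpExtension_holds ↥ℚ⟮4 * delta ((⟨1, 1, 0, -1, -4⟩ : WeierstrassCurve ℤ).baseChange ℚ) two_ne_zero⟯ 2
  obtain ⟨hμk, hlk⟩ := classicalLambda_resolvent_n4883 κk hκk
  have hΔ := Δ_n4883_neg
  have hsq : ¬ IsSquare ((⟨1, 1, 0, -1, -4⟩ : WeierstrassCurve ℤ).baseChange ℚ).Δ := fun ⟨r, hr⟩ ↦ by nlinarith [mul_self_nonneg r]
  have h2Δ : ¬ IsSquare (2 * ((⟨1, 1, 0, -1, -4⟩ : WeierstrassCurve ℤ).baseChange ℚ).Δ) := fun ⟨r, hr⟩ ↦ by nlinarith [mul_self_nonneg r]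
  refine ⟨(classicalMuVanishes_divisionField_two_iff_resolvent_of_cubic _ not_hasRationalTwoTorsionX_n4883 hsq h2Δ cubic_towers_two_free_n4883
    κk hκk κT hκT).mpr hμk, ?_⟩
  rw [classicalLambda_divisionField_two_eq_resolvent_of_cubic _ not_hasRationalTwoTorsionX_n4883 hsq h2Δ cubic_towers_two_free_n4883 κk hκk κT hκT, hlk]

end Summit.BirchSwinnertonDyer.BirchSwinnertonDyer.Theorems.AlignedTransportAtTwoSexticResolventExactSeedsB

end
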